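import Literature.AlgebraicGeometry.Resolution.SmoothFactorizationsTransport
import Literature.AlgebraicGeometry.Resolution.GeometricallyRegularFG
import Literature.AlgebraicGeometry.Resolution.RegularHomLocalization
import Mathlib.RingTheory.TensorProduct.Quotient
import HarnessLib

/-!
# The Noetherian induction on the base in the proof of Stacks 07F5

Topic: `Literature/AlgebraicGeometry/Resolution`. Groundwork for the proof of the named fact
`Stacks07F5_reduceToField` (`NeronPopescuSteps.lean`; Stacks, *Smoothing Ring Maps*,
Lemma 07F5). The printed proof begins:

> Let `R → Λ` be as in Situation 07F2 arbitrary. Note that `R/I → Λ/IΛ` is another regular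
> ring map of Noetherian rings, see More on Algebra, Lemma 07C1. Consider the set of ideals
> `𝓘 = {I ⊂ R ∣ R/I → Λ/IΛ does not have PT}`. We have to show that `𝓘` is empty. If this set
> is nonempty, then it contains a maximal element because `R` is Noetherian. Replacing `R` by
> `R/I` and `Λ` by `Λ/I` we obtain a situation where PT holds for `R/I → Λ/IΛ` for any
> nonzero ideal of `R`.

This file PROVES this reduction as a theorem about the tree's notions
(`HasSmoothFactorizations` = PT in factorisation form, `IsRegularHom`):

* `IsRegularHom.quotient` — "`R/I → Λ/IΛ` is another regular ring map" (Stacks 07C1 for the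
  finite type map `R → R/I`, from `IsRegularHom.baseChange_of_essFiniteType` of
  `GeometricallyRegularFG.lean` and Mathlib's `Λ/IΛ ≅ (R/I) ⊗_R Λ`);
* `IsRegularHom.residueField'` — likewise the fibre `κ(𝔭) → κ(𝔭) ⊗_R Λ` as an algebra over
  the residue field is a regular ring map (07C1 for the essentially finite type `R → κ(𝔭)`;
  used in 07F5 for the factors `K_i = κ(𝔭_i)` of the total ring of fractions of a reduced `R`);
* `IsRegularHom.localization_nonZeroDivisors` — and so is `S⁻¹R → S⁻¹Λ` for
  `S` the non-zero-divisors of `R` (any localisation, in fact);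
* `hasSmoothFactorizations_of_forall_quotient` — **the Noetherian induction**: to prove PT for
  every regular homomorphism of Noetherian rings it suffices to prove PT for those regular
  `R → Λ` (with `R ≠ 0`) for which PT already holds for `R/I → Λ/IΛ` for every ideal `I ≠ 0`.

## Sources

* The Stacks Project, *Smoothing Ring Maps* (Tag 07BW), Lemma 07F5 and the first paragraph of
  its proof; *More on Algebra*, Lemma 07C1. [StacksProject]
-/

noncomputable section

open TensorProduct

namespace Literature.AlgebraicGeometry.Resolution

universe u

/-! ## Stacks 07C1 in the three forms used by 07F5 -/

section BaseChange

variable {R Λ : Type u} [CommRing R] [CommRing Λ] [Algebra R Λ]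

/-- **"`R/I → Λ/IΛ` is another regular ring map of Noetherian rings"** (proof of Stacks 07F5,
citing More on Algebra 07C1): base change of the regular `R → Λ` along the finite type map
`R → R/I`, read through `Λ/IΛ ≅ (R/I) ⊗_R Λ`. [cite: StacksProject, Tag 07C1] -/
theorem IsRegularHom.quotient [IsNoetherianRing Λ] (h : IsRegularHom R Λ) (I : Ideal R) :
    IsRegularHom (R ⧸ I) (Λ ⧸ I.map (algebraMap R Λ)) :=
  (h.baseChange_of_essFiniteType (R ⧸ I)).of_algEquiv
    (Algebra.TensorProduct.quotIdealMapEquivQuotTensor Λ I).symm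

/-- The fibre `κ(𝔭) → κ(𝔭) ⊗_R Λ` of a regular `R → Λ` (with `Λ` Noetherian), as an algebra
over the residue field, is a regular ring map: Stacks 07C1 for the essentially finite type
map `R → κ(𝔭)`. [cite: StacksProject, Tag 07C1] -/
theorem IsRegularHom.residueField' [IsNoetherianRing Λ] (h : IsRegularHom R Λ) (p : Ideal R)
    [p.IsPrime] : IsRegularHom p.ResidueField (p.ResidueField ⊗[R] Λ) :=
  h.baseChange_of_essFiniteType p.ResidueField

/-- **`S⁻¹R → S⁻¹Λ` is regular** for a regular `R → Λ` of Noetherian rings and any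
localisation (in 07F5: `S` the non-zero-divisors of `R`, "PT holds for the ring map
`S⁻¹R → S⁻¹Λ`" being deduced from the field case). Here `S⁻¹R`, `S⁻¹Λ` are arbitrary
localisations `Q`, `Λ'` at `S` and at the image of `S`. [cite: StacksProject, Tag 07F5 (proof)] -/
theorem IsRegularHom.isLocalization [IsNoetherianRing Λ] (h : IsRegularHom R Λ)
    (S : Submonoid R) (Q Λ' : Type u) [CommRing Q] [Algebra R Q] [IsLocalization S Q]
    [CommRing Λ'] [Algebra Λ Λ'] [Algebra R Λ'] [IsScalarTower R Λ Λ']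
    [IsLocalization (Algebra.algebraMapSubmonoid Λ S) Λ'] [Algebra Q Λ']
    [IsScalarTower R Q Λ'] : IsRegularHom Q Λ' :=
  (h.comp_isLocalization_right (Algebra.algebraMapSubmonoid Λ S) Λ').of_isLocalization_left S Q Λ'

end BaseChange

/-! ## The Noetherian induction on the ideals of `R` -/

section Induction

/-- **The first reduction in the proof of Stacks 07F5** (Noetherian induction on the base).
Suppose that for every regular homomorphism `R → Λ` of Noetherian rings with `R ≠ 0` such
that PT holds for `R/I → Λ/IΛ` for every nonzero ideal `I` of `R`, PT holds for `R → Λ`.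
Then PT holds for every regular homomorphism of Noetherian rings. (Printed: "Consider the set
of ideals `𝓘 = {I ⊂ R ∣ R/I → Λ/IΛ does not have PT}` … it contains a maximal element because
`R` is Noetherian. Replacing `R` by `R/I` and `Λ` by `Λ/I` we obtain a situation where PT holds
for `R/I → Λ/IΛ` for any nonzero ideal of `R`.") We run `IsNoetherian.induction` on the
statement "PT holds for `R/I → Λ/IΛ`", using that `R/I → Λ/IΛ` is again regular
(`IsRegularHom.quotient`), the identifications `(R/I)/(J/I) ≅ R/J`, `(Λ/IΛ)/(J/I)(Λ/IΛ) ≅ Λ/JΛ`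
(`HasSmoothFactorizations.quotQuot`) and `R/0 ≅ R` (`HasSmoothFactorizations.of_quotient_bot`);
the zero ring is covered by `hasSmoothFactorizations_of_subsingleton`.
[cite: StacksProject, Tag 07F5 (proof)] -/
theorem hasSmoothFactorizations_of_forall_quotient
    (step : ∀ (R Λ : Type u) [CommRing R] [CommRing Λ] [Algebra R Λ] [Nontrivial R],
      IsNoetherianRing R → IsNoetherianRing Λ → IsRegularHom R Λ →
        (∀ I : Ideal R, I ≠ ⊥ →
          HasSmoothFactorizations (R ⧸ I) (Λ ⧸ I.map (algebraMap R Λ))) →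
        HasSmoothFactorizations R Λ)
    (R Λ : Type u) [CommRing R] [CommRing Λ] [Algebra R Λ] [IsNoetherianRing R]
    [IsNoetherianRing Λ] (h : IsRegularHom R Λ) : HasSmoothFactorizations R Λ := by
  suffices key : ∀ I : Ideal R, HasSmoothFactorizations (R ⧸ I) (Λ ⧸ I.map (algebraMap R Λ)) from
    (key ⊥).of_quotient_bot
  intro I
  induction I using IsNoetherian.induction with
  | hgt I ih =>
    rcases subsingleton_or_nontrivial (R ⧸ I) with hI | hI
    · exact hasSmoothFactorizations_of_subsingleton _ _
    · refine step (R ⧸ I) (Λ ⧸ Ideal.map (algebraMap R Λ) I) inferInstance inferInstance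
        (h.quotient I) fun J' hJ' => ?_
      have hle : I ≤ J'.comap (Ideal.Quotient.mk I) := fun x hx => by
        rw [Ideal.mem_comap, Ideal.Quotient.eq_zero_iff_mem.mpr hx]
        exact J'.zero_mem
      have hlt : I < J'.comap (Ideal.Quotient.mk I) := by
        refine lt_of_le_of_ne hle fun heq => hJ' ?_
        rw [← Ideal.map_comap_of_surjective (Ideal.Quotient.mk I) Ideal.Quotient.mk_surjective J',
          ← heq, Ideal.map_quotient_self]
      exact (ih _ hlt).quotQuot I J'

end Induction

end Literature.AlgebraicGeometry.Resolution

end
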